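import Literature.NumberTheory.Rogawski1990.CMCharIdentityClauses
import Literature.NumberTheory.Rogawski1990.LocalTransferFundamentalLemma
import Literature.NumberTheory.Rogawski1990.XiLocalCharacterSplit
import Literature.NumberTheory.Automorphic.VanDijkTraceParabolicIndGL
import Literature.NumberTheory.Automorphic.GodementHeightFloor
import Literature.NumberTheory.Automorphic.UnitaryGroupConstantTermSplit
import Literature.NumberTheory.Automorphic.GLnStandardLeviUnimodular
import Literature.NumberTheory.Automorphic.ParabolicGLProofs
import Summits.HodgeConjecture.HodgeConjecture.Theorems.F0P3bCharIdentityTransport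
import Literature.NumberTheory.Automorphic.Liu2021.LemD1SplitPlaceOfFacts
import HarnessLib

/-!
# Line «CMCharIdentityTest» (F0P3b), stub (b) `stub_vanDijkSplit` SPLIT AT ITS GL JOINT:
# the GL-level van Dijk formula for `Ind_{P_{(2,1)}}^{GL₃}(ν₀ ∘ det ⊠ ψ_w)` (+ its admissibility) ⇒ `charDist ξ_v (cmSplitTransfer f) = Tr i_G(ξ_w ⊗ μ_w∘det₀)(f)`

Cell `pub/hodgecm-mathlib`, crux H413 = `stmt-HodgeConjecture-24833`; line file `Cruxes/H413/Lines/F0_P3b_CMCharIdentityTestPaydown.lean` ED. 6 (desk F0P3b-plan (g12)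
«(b) split at its GL joint», 04:17:45Z (s1)–(s3)).  THEOREMS ONLY (no definition, no instance, no notation, no named fact, no `sorry`); kernel lane
`--supports stmt-HodgeConjecture-24833`.  HONEST LABEL: HC_CM is proved only modulo the printed citations (2 remaining named inputs hLiu418, h413) until rung
0 closes; this file pays nothing by itself — it REDUCES the stub (b) [Rogawski1990, Lemma 4.13.1 (b)] to two GL₃-currency statements.

THE REDUCTION.  `vanDijkSplit_of_vanDijkGL hadm hVD : <text of stub_vanDijkSplit, ED. 6 :244, verbatim>` from
* `hadm` — admissibility of the normalised induced character `Representation.parabolicIndGL F (lastBlockLabel 3) (𝟙.twist (maxParabolicLeviChar F 3 ν₀ χ′))` for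
  unitary continuous `ν₀, χ′` (an instance of ★ `Representation.isAdmissible_parabolicIndGL_holds` once `𝟙.twist χ` is known admissible — open kernel);
* `hVD` — ★ `VanDijkTraceParabolicIndGL` (p840961) at `F = L_w`, `c = lastBlockLabel 3`, `χ = maxParabolicLeviChar L_w 3 (ξ.splitν₀ μ w) (ξ.locψ w)` and the
  pair of measures `(e′_* νG_v, jj_* νH_v)` (`e′ = cmSplitEquiv`, `jj = cmSplitLeviHom`), in the (b)-frame.
Proof = bookkeeping: `charDist = ∫ ξ_v · (cmSplitTransfer f)` (★ `charDist_def`) `= (νG K′∕νH K_H) ∫ ξ_v μ_w(det e₂ ·) f̄^P` (★ `integral_mul_cmSplitTransfer`); the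
integrand is the van Dijk integrand at `jj h` by THE ξ-DICTIONARY ★ `coe_xiLocalChar_mul_localComponent_eq_maxParabolicLeviChar` (p841034) and ★
`cmConstantTermSplit_apply`; `∫_M · d(jj_* νH) = ∫_H · ∘ jj dνH` because `jj` is a closed embedding (★ `exists_continuousMulEquiv_prod_standardLeviGL_twoBlock`,
`MeasurableEmbedding.integral_map`); the constants agree by `Measure.map_apply` (`e′⁻¹ GL₃(𝒪) = K′`, `jj⁻¹ (M ∩ GL₃(𝒪)) = K_H`, definitional); and the trace
side is moved from `G′_v` to `GL₃(L_w)` by ★ `F0P3bCharIdentityTransport.smoothTrace_comap` (★ `cmSplitPacket_πn`).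

## References
* [Rogawski1990] J. D. Rogawski, *Automorphic Representations of Unitary Groups in Three Variables* (1990), §4.13 Lemma 4.13.1 (b) p. 64; §13.3 p. 202.
* [vanDijk1972] G. van Dijk, *Computation of certain induced characters of 𝔭-adic groups*, Math. Ann. 199 (1972), 229–240.
* [BernsteinZelevinsky1977] I. N. Bernstein, A. V. Zelevinsky, *Induced representations of reductive 𝔭-adic groups I*, §2.3.
-/

set_option autoImplicit false
set_option linter.dupNamespace false

noncomputable section

open NumberField IsDedekindDomain MeasureTheory MeasureTheory.Measure Topology
open scoped Matrix MatrixGroups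
open Literature.NumberTheory.Rogawski1990 Literature.NumberTheory.Automorphic Literature.NumberTheory.Automorphic.UnitaryGroup
open Literature.NumberTheory.GaloisRepresentations Literature.NumberTheory.Automorphic.Arthur2013.Leaves.TECR
open Literature.NumberTheory.Automorphic.Zelevinsky1980

namespace Summit.HodgeConjecture.HodgeConjecture.Cruxes.H413.F0P3bVanDijkSplitOfGL

set_option maxHeartbeats 1600000 in
/-- **(b) from the GL joint.**  With `hadm` (admissibility of `Ind(ν₀ ∘ det ⊠ χ′)` on `GL₃(F)`) and `hVD` (van Dijk's trace formula ★ `VanDijkTraceParabolicIndGL` at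
`(L_w, (2,1), maxParabolicLeviChar ν₀ ψ_w, e′_* νG_v, jj_* νH_v)` in the (b)-frame), the split-place identity of [Rogawski1990, Lemma 4.13.1 (b)] holds in the
line's currency: `charDist ξ_v νH_v (cmSplitTransfer … f) = Tr (cmSplitPacket …).πn (f)` — the text of `stub_vanDijkSplit` (ED. 6 :244) verbatim.
[cite: Rogawski1990, §4.13 Lemma 4.13.1 (b) p. 64; §13.3 p. 202] [cite: BernsteinZelevinsky1977, §2.3] -/
theorem vanDijkSplit_of_vanDijkGL
    (hadm : ∀ (F : Type) [Field F] [ValuativeRel F] [TopologicalSpace F] [IsNonarchimedeanLocalField F]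
      [LocallyCompactSpace (standardParabolicGL F (lastBlockLabel 3))] (ν₀ χ' : Fˣ →* ℂˣ),
      (∀ x, ‖((ν₀ x : ℂˣ) : ℂ)‖ = 1) → (Continuous fun x => ((ν₀ x : ℂˣ) : ℂ)) → (∀ x, ‖((χ' x : ℂˣ) : ℂ)‖ = 1) →
      (Continuous fun x => ((χ' x : ℂˣ) : ℂ)) →
      (Representation.parabolicIndGL F (lastBlockLabel 3)
        ((Representation.trivial ℂ (Π a, GL {i : Fin 3 // lastBlockLabel 3 i = a} F) ℂ).twist (maxParabolicLeviChar F 3 ν₀ χ'))).IsAdmissible)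
    (hVD : ∀ (L : Type) [Field L] [NumberField L] [IsCMField L] (H : Matrix (Fin 3) (Fin 3) L) (μ : HeckeCharacter L)
      [∀ v : HeightOneSpectrum (𝓞 ↥(maximalRealSubfield L)), MeasurableSpace
        ((cmDatum L 2 (Matrix.of fun i j : Fin 2 => if i.val + j.val + 1 = 2 then (1 : L) else 0)).Local v ×
          (cmDatum L 1 (Matrix.of fun i j : Fin 1 => if i.val + j.val + 1 = 1 then (1 : L) else 0)).Local v)]
      [∀ v : HeightOneSpectrum (𝓞 ↥(maximalRealSubfield L)), BorelSpace
        ((cmDatum L 2 (Matrix.of fun i j : Fin 2 => if i.val + j.val + 1 = 2 then (1 : L) else 0)).Local v ×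
          (cmDatum L 1 (Matrix.of fun i j : Fin 1 => if i.val + j.val + 1 = 1 then (1 : L) else 0)).Local v)]
      [∀ v : HeightOneSpectrum (𝓞 ↥(maximalRealSubfield L)), MeasurableSpace ((cmDatum L 3 H).Local v)]
      [∀ v : HeightOneSpectrum (𝓞 ↥(maximalRealSubfield L)), BorelSpace ((cmDatum L 3 H).Local v)]
      (νH : ∀ v : HeightOneSpectrum (𝓞 ↥(maximalRealSubfield L)), Measure
        ((cmDatum L 2 (Matrix.of fun i j : Fin 2 => if i.val + j.val + 1 = 2 then (1 : L) else 0)).Local v ×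
          (cmDatum L 1 (Matrix.of fun i j : Fin 1 => if i.val + j.val + 1 = 1 then (1 : L) else 0)).Local v))
      (νG : ∀ v : HeightOneSpectrum (𝓞 ↥(maximalRealSubfield L)), Measure ((cmDatum L 3 H).Local v))
      [∀ v, (νH v).IsHaarMeasure] [∀ v, (νH v).IsMulRightInvariant] [∀ v, (νG v).IsHaarMeasure] [∀ v, (νG v).IsMulRightInvariant]
      (hμu : μ.IsUnitary)
      (_hμω : ∀ x : Literature.NumberTheory.GaloisRepresentations.ideleGroup ↥(maximalRealSubfield L),
        μ (AdeleRing.ideleBaseChange (↥(maximalRealSubfield L)) L x) = quadraticHeckeCharCM L x)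
      (hherm : (H.map (cmConjRingHom L))ᵀ = H)
      (hanis : ∀ x : Fin 3 → L, Literature.AlgebraicGeometry.ShimuraVarieties.hermForm (cmConjRingHom L) H x x = 0 → x = 0)
      (ξ : OneDimAutRepH L) (v : HeightOneSpectrum (𝓞 ↥(maximalRealSubfield L)))
      (hs : ∃ w : PlacesOver L v, IsCMField.complexConj L • w.1 ≠ w.1),
      letI : MeasurableSpace (GL (Fin 3) ((splitWitness v hs).1.adicCompletion L)) := borel _
      VanDijkTraceParabolicIndGL ((splitWitness v hs).1.adicCompletion L) (lastBlockLabel 3)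
        (maxParabolicLeviChar ((splitWitness v hs).1.adicCompletion L) 3 (ξ.splitν₀ μ (splitWitness v hs).1) (ξ.locψ (splitWitness v hs).1))
        (Measure.map (cmSplitEquiv L H hherm (isUnit_iff_ne_zero.mpr (Godement.det_ne_zero_of_anisotropic L H hanis)) v (splitWitness v hs)
          (splitWitness_spec v hs)) (νG v))
        (Measure.map (cmSplitLeviHom L v (splitWitness v hs) (splitWitness_spec v hs)) (νH v))) :
  ∀ (L : Type) [Field L] [NumberField L] [IsCMField L] (H : Matrix (Fin 3) (Fin 3) L) (μ : HeckeCharacter L)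
    [∀ v : HeightOneSpectrum (𝓞 ↥(maximalRealSubfield L)), MeasurableSpace
      ((cmDatum L 2 (Matrix.of fun i j : Fin 2 => if i.val + j.val + 1 = 2 then (1 : L) else 0)).Local v ×
        (cmDatum L 1 (Matrix.of fun i j : Fin 1 => if i.val + j.val + 1 = 1 then (1 : L) else 0)).Local v)]
    [∀ v : HeightOneSpectrum (𝓞 ↥(maximalRealSubfield L)), BorelSpace
      ((cmDatum L 2 (Matrix.of fun i j : Fin 2 => if i.val + j.val + 1 = 2 then (1 : L) else 0)).Local v ×
        (cmDatum L 1 (Matrix.of fun i j : Fin 1 => if i.val + j.val + 1 = 1 then (1 : L) else 0)).Local v)]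
    [∀ v : HeightOneSpectrum (𝓞 ↥(maximalRealSubfield L)), MeasurableSpace ((cmDatum L 3 H).Local v)]
    [∀ v : HeightOneSpectrum (𝓞 ↥(maximalRealSubfield L)), BorelSpace ((cmDatum L 3 H).Local v)]
    (νH : ∀ v : HeightOneSpectrum (𝓞 ↥(maximalRealSubfield L)), Measure
      ((cmDatum L 2 (Matrix.of fun i j : Fin 2 => if i.val + j.val + 1 = 2 then (1 : L) else 0)).Local v ×
        (cmDatum L 1 (Matrix.of fun i j : Fin 1 => if i.val + j.val + 1 = 1 then (1 : L) else 0)).Local v))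
    (νG : ∀ v : HeightOneSpectrum (𝓞 ↥(maximalRealSubfield L)), Measure ((cmDatum L 3 H).Local v))
    [∀ v, (νH v).IsHaarMeasure] [∀ v, (νH v).IsMulRightInvariant] [∀ v, (νG v).IsHaarMeasure] [∀ v, (νG v).IsMulRightInvariant]
    (hμu : μ.IsUnitary)
    (_hμω : ∀ x : Literature.NumberTheory.GaloisRepresentations.ideleGroup ↥(maximalRealSubfield L),
      μ (AdeleRing.ideleBaseChange (↥(maximalRealSubfield L)) L x) = quadraticHeckeCharCM L x)
    (hherm : (H.map (cmConjRingHom L))ᵀ = H)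
    (hanis : ∀ x : Fin 3 → L, Literature.AlgebraicGeometry.ShimuraVarieties.hermForm (cmConjRingHom L) H x x = 0 → x = 0),
    ∀ (ξ : OneDimAutRepH L) (v : HeightOneSpectrum (𝓞 ↥(maximalRealSubfield L)))
      (hs : ∃ w : PlacesOver L v, IsCMField.complexConj L • w.1 ≠ w.1) (f : (cmDatum L 3 H).Local v → ℂ), IsLocSmooth f →
      charDist (ξ.xiLocalChar v) (νH v) (cmSplitTransfer L H hherm (isUnit_iff_ne_zero.mpr (Godement.det_ne_zero_of_anisotropic L H hanis)) v (splitWitness v hs)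
            (splitWitness_spec v hs) μ (νH v) (νG v) f) =
        ((cmSplitPacket L H hherm (isUnit_iff_ne_zero.mpr (Godement.det_ne_zero_of_anisotropic L H hanis)) v (splitWitness v hs) (splitWitness_spec v hs)
              (ξ.splitν₀ μ (splitWitness v hs).1)
              (ξ.locψ (splitWitness v hs).1) (ξ.norm_splitν₀_apply hμu (splitWitness v hs).1)
              (ξ.continuous_splitν₀ μ (splitWitness v hs).1) (ξ.norm_locψ_apply (splitWitness v hs).1)
              (ξ.continuous_locψ (splitWitness v hs).1)).πn).smoothTrace (νG v) f := by
  intro L _ _ _ H μ _ _ _ _ νH νG _ _ _ _ hμu hμω hherm hanis ξ v hs f hf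
  -- notation (no `set` for `w`: the goal keeps `splitWitness v hs` literally)
  have hw : IsCMField.complexConj L • (splitWitness v hs).1 ≠ (splitWitness v hs).1 := splitWitness_spec v hs
  letI : MeasurableSpace (GL (Fin 3) ((splitWitness v hs).1.adicCompletion L)) := borel _
  haveI : BorelSpace (GL (Fin 3) ((splitWitness v hs).1.adicCompletion L)) := ⟨rfl⟩
  set hdet : IsUnit H.det := isUnit_iff_ne_zero.mpr (Godement.det_ne_zero_of_anisotropic L H hanis) with hdetdef
  set e' := cmSplitEquiv L H hherm hdet v (splitWitness v hs) (splitWitness_spec v hs) with he'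
  set r : SmoothIrrep (GL (Fin 3) ((splitWitness v hs).1.adicCompletion L)) :=
    splitMemberGL ((splitWitness v hs).1.adicCompletion L) (ξ.splitν₀ μ (splitWitness v hs).1) (ξ.locψ (splitWitness v hs).1)
      (ξ.norm_splitν₀_apply hμu (splitWitness v hs).1) (ξ.continuous_splitν₀ μ (splitWitness v hs).1) (ξ.norm_locψ_apply (splitWitness v hs).1)
      (ξ.continuous_locψ (splitWitness v hs).1) with hr
  have hadm' : r.ρ.IsAdmissible :=
    hadm ((splitWitness v hs).1.adicCompletion L) (ξ.splitν₀ μ (splitWitness v hs).1) (ξ.locψ (splitWitness v hs).1)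
      (ξ.norm_splitν₀_apply hμu (splitWitness v hs).1) (ξ.continuous_splitν₀ μ (splitWitness v hs).1) (ξ.norm_locψ_apply (splitWitness v hs).1)
      (ξ.continuous_locψ (splitWitness v hs).1)
  -- the test function on `GL₃(L_w)`
  set f' : GL (Fin 3) ((splitWitness v hs).1.adicCompletion L) → ℂ := f ∘ e'.symm with hf'
  have hf'lc : IsLocallyConstant f' := hf.1.comp_continuous e'.symm.continuous
  have hf'cs : HasCompactSupport f' := hf.2.comp_homeomorph e'.symm.toHomeomorph
  -- (R) the trace side, transported to `GL₃(L_w)`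
  have hR : ((cmSplitPacket L H hherm hdet v (splitWitness v hs) (splitWitness_spec v hs) (ξ.splitν₀ μ (splitWitness v hs).1)
        (ξ.locψ (splitWitness v hs).1) (ξ.norm_splitν₀_apply hμu (splitWitness v hs).1) (ξ.continuous_splitν₀ μ (splitWitness v hs).1)
        (ξ.norm_locψ_apply (splitWitness v hs).1) (ξ.continuous_locψ (splitWitness v hs).1)).πn).smoothTrace (νG v) f =
      r.ρ.smoothTrace ((νG v).map e') f' := by
    rw [cmSplitPacket_πn, ← IrrClass.comap_mk, ← IrrClass.smoothTrace_mk]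
    have hff : f = f' ∘ e' := funext fun g => by simp only [hf', Function.comp_apply, ContinuousMulEquiv.symm_apply_apply]
    conv_lhs => rw [hff]
    exact F0P3bCharIdentityTransport.smoothTrace_comap e' r hadm' (νG v) f'
  rw [hR]
  -- (V) van Dijk on `GL₃(L_w)`
  have hV := hVD L H μ νH νG hμu hμω hherm hanis ξ v hs f' hf'lc hf'cs
  change r.ρ.smoothTrace ((νG v).map e') f' = _ at hV
  rw [hV, charDist_def, integral_mul_cmSplitTransfer]
  -- (C) the constants: `e′_* νG (GL₃(𝒪)) = νG K′`, `jj_* νH (M ∩ GL₃(𝒪)) = νH K_H`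
  have hme : Measurable (e' : (cmDatum L 3 H).Local v → GL (Fin 3) ((splitWitness v hs).1.adicCompletion L)) := e'.continuous.measurable
  have hmj : Measurable (cmSplitLeviHom L v (splitWitness v hs) (splitWitness_spec v hs) :
      _ → ↥(standardLeviGL ((splitWitness v hs).1.adicCompletion L) (lastBlockLabel 3))) :=
    (continuous_cmSplitLeviHom L v (splitWitness v hs) (splitWitness_spec v hs)).measurable
  have hmsK : MeasurableSet (glInt 3 ((splitWitness v hs).1.adicCompletion L) : Set (GL (Fin 3) ((splitWitness v hs).1.adicCompletion L))) :=
    (isOpen_glInt (n := 3) (F := (splitWitness v hs).1.adicCompletion L)).measurableSet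
  have hmsM : MeasurableSet {m : ↥(standardLeviGL ((splitWitness v hs).1.adicCompletion L) (lastBlockLabel 3)) |
      (m : GL (Fin 3) ((splitWitness v hs).1.adicCompletion L)) ∈ glInt 3 ((splitWitness v hs).1.adicCompletion L)} :=
    ((isOpen_glInt (n := 3) (F := (splitWitness v hs).1.adicCompletion L)).preimage continuous_subtype_val).measurableSet
  have hK : (Measure.map e' (νG v)) (glInt 3 ((splitWitness v hs).1.adicCompletion L) : Set (GL (Fin 3) ((splitWitness v hs).1.adicCompletion L))) =
      νG v (cmSplitMaxCompact L v (splitWitness v hs) (splitWitness_spec v hs) H hherm hdet) := by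
    rw [Measure.map_apply hme hmsK]
    rfl
  have hKH : (Measure.map (cmSplitLeviHom L v (splitWitness v hs) (splitWitness_spec v hs)) (νH v))
      {m : ↥(standardLeviGL ((splitWitness v hs).1.adicCompletion L) (lastBlockLabel 3)) |
        (m : GL (Fin 3) ((splitWitness v hs).1.adicCompletion L)) ∈ glInt 3 ((splitWitness v hs).1.adicCompletion L)} =
      νH v (cmSplitLeviCompact L v (splitWitness v hs) (splitWitness_spec v hs)) := by
    rw [Measure.map_apply hmj hmsM]
    rfl
  rw [hK, hKH]
  congr 1
  -- (J) `∫_M Φ d(jj_* νH) = ∫_H Φ ∘ jj dνH`: `jj` is a closed embedding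
  have hjj : IsClosedEmbedding (cmSplitLeviHom L v (splitWitness v hs) (splitWitness_spec v hs)) := by
    -- `x ↦ reindexGL E (diag x)` is a closed embedding `GL₂ × GL₁ → GL₃` (a homeomorphism onto the closed Levi `M`)
    haveI := (IsNonarchimedeanLocalField.isLocalField ((splitWitness v hs).1.adicCompletion L)).toT2Space
    obtain ⟨E0, hE0⟩ := exists_continuousMulEquiv_prod_standardLeviGL_twoBlock (S := (splitWitness v hs).1.adicCompletion L) (k := 2) (l := 1)
    have hφ : IsClosedEmbedding (fun x : GL (Fin 2) ((splitWitness v hs).1.adicCompletion L) × GL (Fin 1) ((splitWitness v hs).1.adicCompletion L) =>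
        UnitaryGroup.reindexGL finSumFinEquiv (UnitaryGroup.blockDiagGL x)) := by
      have h1 : (fun x : GL (Fin 2) ((splitWitness v hs).1.adicCompletion L) × GL (Fin 1) ((splitWitness v hs).1.adicCompletion L) =>
          UnitaryGroup.reindexGL finSumFinEquiv (UnitaryGroup.blockDiagGL x)) = Subtype.val ∘ E0 := funext fun x => (hE0 x).symm
      rw [h1]
      exact (IsClosed.isClosedEmbedding_subtypeVal (isClosed_standardLeviGL _)).comp E0.toHomeomorph.isClosedEmbedding
    have hψ : IsClosedEmbedding (cmSplitLeviGL L v (splitWitness v hs) (splitWitness_spec v hs)) := by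
      have h2 : (cmSplitLeviGL L v (splitWitness v hs) (splitWitness_spec v hs) : _ → GL (Fin 3) ((splitWitness v hs).1.adicCompletion L)) =
          (fun x : GL (Fin 2) ((splitWitness v hs).1.adicCompletion L) × GL (Fin 1) ((splitWitness v hs).1.adicCompletion L) =>
            UnitaryGroup.reindexGL finSumFinEquiv (UnitaryGroup.blockDiagGL x)) ∘
            (fun h => (cmSplitEquivTwo L v (splitWitness v hs) (splitWitness_spec v hs) h.1,
              cmSplitEquivOne L v (splitWitness v hs) (splitWitness_spec v hs) h.2)) := rfl
      rw [h2]
      exact hφ.comp ((cmSplitEquivTwo L v (splitWitness v hs) (splitWitness_spec v hs)).toHomeomorph.prodCongr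
        (cmSplitEquivOne L v (splitWitness v hs) (splitWitness_spec v hs)).toHomeomorph).isClosedEmbedding
    refine ⟨hψ.isEmbedding.codRestrict _ (cmSplitLeviGL_mem_standardLeviGL L v (splitWitness v hs) (splitWitness_spec v hs)), ?_⟩
    have hrange : Set.range (cmSplitLeviHom L v (splitWitness v hs) (splitWitness_spec v hs)) =
        Subtype.val ⁻¹' Set.range (cmSplitLeviGL L v (splitWitness v hs) (splitWitness_spec v hs)) := by
      ext m
      constructor
      · rintro ⟨h, rfl⟩; exact ⟨h, rfl⟩
      · rintro ⟨h, hh⟩; exact ⟨h, Subtype.ext hh⟩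
    rw [hrange]
    exact hψ.isClosed_range.preimage continuous_subtype_val
  rw [hjj.measurableEmbedding.integral_map]
  -- (P) pointwise: the van Dijk integrand at `jj h` is `ξ_v(h) μ_w(det e₂ h.1) · f̄^P(h)`
  refine integral_congr_ae (Filter.Eventually.of_forall fun h => ?_)
  beta_reduce
  rw [← mul_assoc]
  erw [coe_xiLocalChar_mul_localComponent_eq_maxParabolicLeviChar L v (splitWitness v hs) (splitWitness_spec v hs) ξ μ h
      (cmSplitLeviGL_mem_standardParabolicGL L v (splitWitness v hs) (splitWitness_spec v hs) h)]
  rfl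

/-! ## ED. 2 — the admissibility input `hadm` DISCHARGED (★ `isAdmissible_parabolicIndGL_holds` + ★ Liu2021 split-place toolkit) -/

/-- **`Ind_{P_{(2,1)}}^{GL₃}(ν₀ ∘ det ⊠ χ′)` is admissible** for continuous `ν₀, χ′ : Fˣ → ℂˣ`: the inducing one-dimensional character has open kernel (★
`Liu2021.SplitPlace.isOpen_ker_of_continuous`, ★ `isOpen_ker_maxParabolicLeviChar`, ★ `isAdmissible_trivial_twist` — no small subgroups in `ℂˣ`) and parabolic
induction preserves admissibility on `GL_n` (★ `Representation.isAdmissible_parabolicIndGL_holds`, [BernsteinZelevinsky1977, Prop. 2.3]).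
[cite: BernsteinZelevinsky1977, §2.3] [cite: BushnellHenniart2006, §1.5] -/
theorem parabolicIndGL_maxParabolicLeviChar_isAdmissible (F : Type) [Field F] [ValuativeRel F] [TopologicalSpace F] [IsNonarchimedeanLocalField F]
    [LocallyCompactSpace (standardParabolicGL F (lastBlockLabel 3))] (ν₀ χ' : Fˣ →* ℂˣ)
    (hν₀c : Continuous fun x => ((ν₀ x : ℂˣ) : ℂ)) (hχ'c : Continuous fun x => ((χ' x : ℂˣ) : ℂ)) :
    (Representation.parabolicIndGL F (lastBlockLabel 3)
      ((Representation.trivial ℂ (Π a, GL {i : Fin 3 // lastBlockLabel 3 i = a} F) ℂ).twist (maxParabolicLeviChar F 3 ν₀ χ'))).IsAdmissible :=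
  Representation.isAdmissible_parabolicIndGL_holds F (lastBlockLabel 3) _
    (Liu2021.SplitPlace.isAdmissible_trivial_twist _
      (Liu2021.SplitPlace.isOpen_ker_maxParabolicLeviChar 3 ν₀ χ' (Liu2021.SplitPlace.isOpen_ker_of_continuous ν₀ hν₀c)
        (Liu2021.SplitPlace.isOpen_ker_of_continuous χ' hχ'c)))

set_option maxHeartbeats 1600000 in
/-- **(b) from van Dijk's GL₃ formula ALONE** (ED. 2): `vanDijkSplit_of_vanDijkGL` with its admissibility input discharged by
`parabolicIndGL_maxParabolicLeviChar_isAdmissible` — the fold target for the desk's `vanDijkSplit_of_line : type_of% stub_vanDijkGL → <(b) text>`.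
[cite: Rogawski1990, §4.13 Lemma 4.13.1 (b) p. 64] [cite: BernsteinZelevinsky1977, §2.3] -/
theorem vanDijkSplit_of_vanDijkGL'
    (hVD : ∀ (L : Type) [Field L] [NumberField L] [IsCMField L] (H : Matrix (Fin 3) (Fin 3) L) (μ : HeckeCharacter L)
      [∀ v : HeightOneSpectrum (𝓞 ↥(maximalRealSubfield L)), MeasurableSpace
        ((cmDatum L 2 (Matrix.of fun i j : Fin 2 => if i.val + j.val + 1 = 2 then (1 : L) else 0)).Local v ×
          (cmDatum L 1 (Matrix.of fun i j : Fin 1 => if i.val + j.val + 1 = 1 then (1 : L) else 0)).Local v)]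
      [∀ v : HeightOneSpectrum (𝓞 ↥(maximalRealSubfield L)), BorelSpace
        ((cmDatum L 2 (Matrix.of fun i j : Fin 2 => if i.val + j.val + 1 = 2 then (1 : L) else 0)).Local v ×
          (cmDatum L 1 (Matrix.of fun i j : Fin 1 => if i.val + j.val + 1 = 1 then (1 : L) else 0)).Local v)]
      [∀ v : HeightOneSpectrum (𝓞 ↥(maximalRealSubfield L)), MeasurableSpace ((cmDatum L 3 H).Local v)]
      [∀ v : HeightOneSpectrum (𝓞 ↥(maximalRealSubfield L)), BorelSpace ((cmDatum L 3 H).Local v)]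
      (νH : ∀ v : HeightOneSpectrum (𝓞 ↥(maximalRealSubfield L)), Measure
        ((cmDatum L 2 (Matrix.of fun i j : Fin 2 => if i.val + j.val + 1 = 2 then (1 : L) else 0)).Local v ×
          (cmDatum L 1 (Matrix.of fun i j : Fin 1 => if i.val + j.val + 1 = 1 then (1 : L) else 0)).Local v))
      (νG : ∀ v : HeightOneSpectrum (𝓞 ↥(maximalRealSubfield L)), Measure ((cmDatum L 3 H).Local v))
      [∀ v, (νH v).IsHaarMeasure] [∀ v, (νH v).IsMulRightInvariant] [∀ v, (νG v).IsHaarMeasure] [∀ v, (νG v).IsMulRightInvariant]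
      (hμu : μ.IsUnitary)
      (_hμω : ∀ x : Literature.NumberTheory.GaloisRepresentations.ideleGroup ↥(maximalRealSubfield L),
        μ (AdeleRing.ideleBaseChange (↥(maximalRealSubfield L)) L x) = quadraticHeckeCharCM L x)
      (hherm : (H.map (cmConjRingHom L))ᵀ = H)
      (hanis : ∀ x : Fin 3 → L, Literature.AlgebraicGeometry.ShimuraVarieties.hermForm (cmConjRingHom L) H x x = 0 → x = 0)
      (ξ : OneDimAutRepH L) (v : HeightOneSpectrum (𝓞 ↥(maximalRealSubfield L)))
      (hs : ∃ w : PlacesOver L v, IsCMField.complexConj L • w.1 ≠ w.1),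
      letI : MeasurableSpace (GL (Fin 3) ((splitWitness v hs).1.adicCompletion L)) := borel _
      VanDijkTraceParabolicIndGL ((splitWitness v hs).1.adicCompletion L) (lastBlockLabel 3)
        (maxParabolicLeviChar ((splitWitness v hs).1.adicCompletion L) 3 (ξ.splitν₀ μ (splitWitness v hs).1) (ξ.locψ (splitWitness v hs).1))
        (Measure.map (cmSplitEquiv L H hherm (isUnit_iff_ne_zero.mpr (Godement.det_ne_zero_of_anisotropic L H hanis)) v (splitWitness v hs)
          (splitWitness_spec v hs)) (νG v))
        (Measure.map (cmSplitLeviHom L v (splitWitness v hs) (splitWitness_spec v hs)) (νH v))) :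
  ∀ (L : Type) [Field L] [NumberField L] [IsCMField L] (H : Matrix (Fin 3) (Fin 3) L) (μ : HeckeCharacter L)
    [∀ v : HeightOneSpectrum (𝓞 ↥(maximalRealSubfield L)), MeasurableSpace
      ((cmDatum L 2 (Matrix.of fun i j : Fin 2 => if i.val + j.val + 1 = 2 then (1 : L) else 0)).Local v ×
        (cmDatum L 1 (Matrix.of fun i j : Fin 1 => if i.val + j.val + 1 = 1 then (1 : L) else 0)).Local v)]
    [∀ v : HeightOneSpectrum (𝓞 ↥(maximalRealSubfield L)), BorelSpace
      ((cmDatum L 2 (Matrix.of fun i j : Fin 2 => if i.val + j.val + 1 = 2 then (1 : L) else 0)).Local v ×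
        (cmDatum L 1 (Matrix.of fun i j : Fin 1 => if i.val + j.val + 1 = 1 then (1 : L) else 0)).Local v)]
    [∀ v : HeightOneSpectrum (𝓞 ↥(maximalRealSubfield L)), MeasurableSpace ((cmDatum L 3 H).Local v)]
    [∀ v : HeightOneSpectrum (𝓞 ↥(maximalRealSubfield L)), BorelSpace ((cmDatum L 3 H).Local v)]
    (νH : ∀ v : HeightOneSpectrum (𝓞 ↥(maximalRealSubfield L)), Measure
      ((cmDatum L 2 (Matrix.of fun i j : Fin 2 => if i.val + j.val + 1 = 2 then (1 : L) else 0)).Local v ×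
        (cmDatum L 1 (Matrix.of fun i j : Fin 1 => if i.val + j.val + 1 = 1 then (1 : L) else 0)).Local v))
    (νG : ∀ v : HeightOneSpectrum (𝓞 ↥(maximalRealSubfield L)), Measure ((cmDatum L 3 H).Local v))
    [∀ v, (νH v).IsHaarMeasure] [∀ v, (νH v).IsMulRightInvariant] [∀ v, (νG v).IsHaarMeasure] [∀ v, (νG v).IsMulRightInvariant]
    (hμu : μ.IsUnitary)
    (_hμω : ∀ x : Literature.NumberTheory.GaloisRepresentations.ideleGroup ↥(maximalRealSubfield L),
      μ (AdeleRing.ideleBaseChange (↥(maximalRealSubfield L)) L x) = quadraticHeckeCharCM L x)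
    (hherm : (H.map (cmConjRingHom L))ᵀ = H)
    (hanis : ∀ x : Fin 3 → L, Literature.AlgebraicGeometry.ShimuraVarieties.hermForm (cmConjRingHom L) H x x = 0 → x = 0),
    ∀ (ξ : OneDimAutRepH L) (v : HeightOneSpectrum (𝓞 ↥(maximalRealSubfield L)))
      (hs : ∃ w : PlacesOver L v, IsCMField.complexConj L • w.1 ≠ w.1) (f : (cmDatum L 3 H).Local v → ℂ), IsLocSmooth f →
      charDist (ξ.xiLocalChar v) (νH v) (cmSplitTransfer L H hherm (isUnit_iff_ne_zero.mpr (Godement.det_ne_zero_of_anisotropic L H hanis)) v (splitWitness v hs)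
            (splitWitness_spec v hs) μ (νH v) (νG v) f) =
        ((cmSplitPacket L H hherm (isUnit_iff_ne_zero.mpr (Godement.det_ne_zero_of_anisotropic L H hanis)) v (splitWitness v hs) (splitWitness_spec v hs)
              (ξ.splitν₀ μ (splitWitness v hs).1)
              (ξ.locψ (splitWitness v hs).1) (ξ.norm_splitν₀_apply hμu (splitWitness v hs).1)
              (ξ.continuous_splitν₀ μ (splitWitness v hs).1) (ξ.norm_locψ_apply (splitWitness v hs).1)
              (ξ.continuous_locψ (splitWitness v hs).1)).πn).smoothTrace (νG v) f :=
  vanDijkSplit_of_vanDijkGL (fun F _ _ _ _ _ ν₀ χ' _ hν₀c _ hχ'c => parabolicIndGL_maxParabolicLeviChar_isAdmissible F ν₀ χ' hν₀c hχ'c) hVD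

end Summit.HodgeConjecture.HodgeConjecture.Cruxes.H413.F0P3bVanDijkSplitOfGL

end
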